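import Summits.CriticalPhenomena.PercolationContinuityZ3.Theorems.Transplant.FKConnectivityAllQHubCov
import Summits.CriticalPhenomena.PercolationContinuityZ3.Theorems.Transplant.FKConnectivityAllQPendantTools
import HarnessLib

/-!
# Connectivity correlation inequalities for `φ_{w,q}`, every `q > 0` — the hub covariance bound, file 3:
# the PENDANT-HUB (degree-three) REDUCTION

Support file (`--supports stmt-CriticalPhenomena-4575`), FK sub-lane `prim-bschramm-fk-3` (gen 7) of the post-continuity
programme; builds on p205010 (kernel theorem, internal audit signed; external expert review pending).  No definitions, no named
facts, no sorries; standard axioms.  Uses `…AllQHubCov.lean` (statement + mass form) and fk-1 g5's apex/pendant mass identities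
(`…AllQApexMass.lean`).

THE REDUCTION (new; exact).  Let every live pair of `w` at the hub `x` be the single pair `P = xu`, `p = w(P)`, `w° = w[P ↦ 0]`, and let
`A°, B°uy, B°uz, B°yz, C°, Z°` be the partition-pattern masses of `(u; y, z)` under `φ_{w°}`.  Then the three-point expression of
`(x; y, z)` under `φ_w` decomposes as
`TP_w(x; y, z) = (1 − p)²·(B°yz + C°)·Z° + (1 − p)(p/q)·Z°·(2B°yz + q·C°) + (p/q)²·TP_{w°}(u; y, z)`,
so `HubCovBound(w°; u, y, z) ⇒ HubCovBound(w; x, y, z)` for every `q > 0` (`hubCovBoundUnder_of_pendant`); in graph terms: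
NEGATIVE CORRELATION OF `xy, xz` AT A VERTEX `x` OF DEGREE THREE (third neighbour `u`) FOLLOWS FROM NEGATIVE CORRELATION OF `uy, uz`
IN `(G − x) + uy + uz` (`negCorr_adj_of_degree_three`) — a `Y`-to-vertex move that strictly decreases the number of vertices.
Ingredients: leaf lemmas (`pendant_reachable_iff`, `pendant_reachable_hub_iff`), the open / closed one-pair splits
`S_w(J_P ∩ E) = p q⁻¹ S_{w°}(E')`, `S_w(J_Pᶜ ∩ E) = (1 − p) S_{w°}(E)`.
[cite: Grimmett2006, Thm. (3.1)(a) (p. 37); §1.4 eq. (1.20) (p. 15); §3.9 eq. (3.94) (p. 63)] [cite: Wagner2006, Conj. 5.3 (p. 13)]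
-/

noncomputable section

namespace Summit.CriticalPhenomena.PercolationContinuityZ3.Theorems

namespace FK

open MeasureTheory Set Literature.Probability.LatticeModels Literature.Probability.Percolation
open Literature.Probability.Percolation.DecisionTree (ind ind_of_mem ind_of_not_mem ind_nonneg)
open scoped Classical symmDiff

variable {V : Type*} [Fintype V]

/-! ### Pendant hub: the reduction -/

/-- **PENDANT HUB REDUCTION for the hub covariance bound.**  Let `0 < q`, let `x, u, y, z` be distinct, and let `w` be a weight
vector whose only live pair at `x` is `P = xu` (`w(xv) = 0` for `v ≠ u`).  If the hub covariance bound holds for `φ_{w[P ↦ 0]}` at the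
hub `u` and the pair `y, z`, then it holds for `φ_w` at the hub `x` and the pair `y, z`.  Exact reason: with `p = w(P)` and the
pattern masses `A°, B°uy, B°uz, B°yz, C°, Z°` of `(u; y, z)` under `w° = w[P ↦ 0]`,
`TP_w(x; y, z) = (1 − p)²(B°yz + C°)Z° + (1 − p)(p/q)·Z°·(2B°yz + q·C°) + (p/q)²·TP_{w°}(u; y, z)`.
In graph terms: negative correlation of `xy, xz` at a vertex `x` of degree three (third neighbour `u`) follows from negative
correlation of `uy, uz` in `(G − x) + uy + uz`. [cite: Grimmett2006, Thm. (3.1)(a) (p. 37); §3.9 eq. (3.94) (p. 63)]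
[cite: Wagner2006, Conj. 5.3 (p. 13)] -/
theorem hubCovBoundUnder_of_pendant {q : ℝ} (hq0 : 0 < q) (w : Sym2 V → unitInterval) {x u y z : V} (hxu : x ≠ u)
    (hxy : x ≠ y) (hxz : x ≠ z) (hyu : y ≠ u) (hzu : z ≠ u)
    (hw : ∀ e : Sym2 V, x ∈ e → ((w e : unitInterval) : ℝ) ≠ 0 → e = s(x, u))
    (h : HubCovBoundUnder (rcMeasureW (Function.update w s(x, u) 0) q ∅) q u y z) :
    HubCovBoundUnder (rcMeasureW w q ∅) q x y z := by
  have hq : q ≠ 0 := hq0.ne'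
  have hPy : s(x, y) ≠ s(x, u) := by
    intro hh; rw [Sym2.eq_iff] at hh
    rcases hh with ⟨-, hh⟩ | ⟨-, hh2⟩
    · exact hyu hh
    · exact hxy hh2.symm
  have hPz : s(x, z) ≠ s(x, u) := by
    intro hh; rw [Sym2.eq_iff] at hh
    rcases hh with ⟨-, hh⟩ | ⟨-, hh2⟩
    · exact hzu hh
    · exact hxz hh2.symm
  have h0y : ((w s(x, y) : unitInterval) : ℝ) = 0 := by
    by_contra hne; exact hPy (hw _ (Sym2.mem_mk_left x y) hne)
  have h0z : ((w s(x, z) : unitInterval) : ℝ) = 0 := by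
    by_contra hne; exact hPz (hw _ (Sym2.mem_mk_left x z) hne)
  rw [hubCovBoundUnder_iff_threePoint hq0] at h ⊢
  -- names
  set w0 : Sym2 V → unitInterval := Function.update w s(x, u) 0 with hw0
  set p : ℝ := ((w s(x, u) : unitInterval) : ℝ) with hp
  set Exy : Set (BondConfig V) := openConn x y
  set Exz : Set (BondConfig V) := openConn x z
  set Eyz : Set (BondConfig V) := openConn y z
  set Euy : Set (BondConfig V) := openConn u y
  set Euz : Set (BondConfig V) := openConn u z
  set A := ∑ ω : BondConfig V, rcWeightW w q ∅ ω * ind (Exyᶜ ∩ Exzᶜ ∩ Eyzᶜ) ω with hA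
  set Bxy := ∑ ω : BondConfig V, rcWeightW w q ∅ ω * ind (Exy ∩ Exzᶜ) ω with hBxy
  set Bxz := ∑ ω : BondConfig V, rcWeightW w q ∅ ω * ind (Exyᶜ ∩ Exz) ω with hBxz
  set Byz := ∑ ω : BondConfig V, rcWeightW w q ∅ ω * ind (Exyᶜ ∩ Eyz) ω with hByz
  set C := ∑ ω : BondConfig V, rcWeightW w q ∅ ω * ind (Exy ∩ Exz) ω with hC
  set Z := rcPartitionFunctionW w q ∅ with hZ
  set A0 := ∑ ω : BondConfig V, rcWeightW w0 q ∅ ω * ind (Euyᶜ ∩ Euzᶜ ∩ Eyzᶜ) ω with hA0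
  set Buy := ∑ ω : BondConfig V, rcWeightW w0 q ∅ ω * ind (Euy ∩ Euzᶜ) ω with hBuy
  set Buz := ∑ ω : BondConfig V, rcWeightW w0 q ∅ ω * ind (Euyᶜ ∩ Euz) ω with hBuz
  set B0 := ∑ ω : BondConfig V, rcWeightW w0 q ∅ ω * ind (Euyᶜ ∩ Eyz) ω with hB0
  set C0 := ∑ ω : BondConfig V, rcWeightW w0 q ∅ ω * ind (Euy ∩ Euz) ω with hC0
  set Z0 := rcPartitionFunctionW w0 q ∅ with hZ0
  -- proxies off `P`
  set Kuy : Set (BondConfig V) := {ω | (openGraph (ω \ {s(x, u)})).Reachable u y} with hKuy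
  set Kuz : Set (BondConfig V) := {ω | (openGraph (ω \ {s(x, u)})).Reachable u z} with hKuz
  set Kyz : Set (BondConfig V) := {ω | (openGraph (ω \ {s(x, u)})).Reachable y z} with hKyz
  have insK : ∀ (a b : V) (ω : BondConfig V),
      ω ∆ {s(x, u)} ∈ {ω : BondConfig V | (openGraph (ω \ {s(x, u)})).Reachable a b} ↔
        ω ∈ {ω : BondConfig V | (openGraph (ω \ {s(x, u)})).Reachable a b} := by
    intro a b ω
    simp only [Set.mem_setOf_eq, symmDiff_singleton_diff_self]
  have insC : ∀ {K1 : Set (BondConfig V)}, (∀ ω : BondConfig V, ω ∆ {s(x, u)} ∈ K1 ↔ ω ∈ K1) →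
      ∀ ω : BondConfig V, ω ∆ {s(x, u)} ∈ K1ᶜ ↔ ω ∈ K1ᶜ := fun h1 ω => by
    rw [Set.mem_compl_iff, Set.mem_compl_iff, h1]
  have insI : ∀ {K1 K2 : Set (BondConfig V)}, (∀ ω : BondConfig V, ω ∆ {s(x, u)} ∈ K1 ↔ ω ∈ K1) →
      (∀ ω : BondConfig V, ω ∆ {s(x, u)} ∈ K2 ↔ ω ∈ K2) →
      ∀ ω : BondConfig V, ω ∆ {s(x, u)} ∈ K1 ∩ K2 ↔ ω ∈ K1 ∩ K2 := fun h1 h2 ω => by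
    rw [Set.mem_inter_iff, Set.mem_inter_iff, h1, h2]
  -- a.s. facts under `w` on `J_P`
  have asw : ∀ ω : BondConfig V, rcWeightW w q ∅ ω ≠ 0 → s(x, u) ∈ ω →
      ((ω ∈ Exy ↔ ω ∈ Kuy) ∧ (ω ∈ Exz ↔ ω ∈ Kuz) ∧ (ω ∈ Eyz ↔ ω ∈ Kyz)) := by
    intro ω hω hP
    have hωx := pendant_of_rcWeightW_ne_zero w q hw hω
    refine ⟨?_, ?_, ?_⟩
    · rw [mem_openConn_iff', pendant_reachable_hub_iff hxy.symm hωx]; simp only [hP, true_and, hKuy, Set.mem_setOf_eq]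
    · rw [mem_openConn_iff', pendant_reachable_hub_iff hxz.symm hωx]; simp only [hP, true_and, hKuz, Set.mem_setOf_eq]
    · rw [mem_openConn_iff', pendant_reachable_iff hxy.symm hxz.symm hωx]; simp only [hKyz, Set.mem_setOf_eq]
  -- a.s. facts under `w0`
  have hw0x := pendant_hyp_update_zero hw
  have asw0 : ∀ ω : BondConfig V, rcWeightW w0 q ∅ ω ≠ 0 →
      ((ω ∈ Kuy ↔ ω ∈ Euy) ∧ (ω ∈ Kuz ↔ ω ∈ Euz) ∧ (ω ∈ Kyz ↔ ω ∈ Eyz) ∧ ω ∉ Exy ∧ ω ∉ Exz) := by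
    intro ω hω
    have hP : s(x, u) ∉ ω := not_mem_of_rcWeightW_ne_zero w0 q (by simp [hw0]) hω
    have hωx := pendant_of_rcWeightW_ne_zero w0 q hw0x hω
    have hd : ω \ {s(x, u)} = ω := Set.sdiff_singleton_eq_self hP
    refine ⟨?_, ?_, ?_, ?_, ?_⟩
    · simp only [hKuy, Set.mem_setOf_eq, hd]; exact (mem_openConn_iff' u y ω).symm
    · simp only [hKuz, Set.mem_setOf_eq, hd]; exact (mem_openConn_iff' u z ω).symm
    · simp only [hKyz, Set.mem_setOf_eq, hd]; exact (mem_openConn_iff' y z ω).symm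
    · rw [mem_openConn_iff', pendant_reachable_hub_iff hxy.symm hωx]; exact fun hh => hP hh.1
    · rw [mem_openConn_iff', pendant_reachable_hub_iff hxz.symm hωx]; exact fun hh => hP hh.1
  -- the five identities
  have idC : C = p * q⁻¹ * C0 := by
    have h1 : C = ∑ ω : BondConfig V, rcWeightW w q ∅ ω * ind ({ω | s(x, u) ∈ ω} ∩ (Exy ∩ Exz)) ω := by
      refine sum_rcWeightW_ind_congr_ae w q fun ω hω => ?_
      simp only [Set.mem_inter_iff, Set.mem_setOf_eq]
      constructor
      · intro hh
        have hP : s(x, u) ∈ ω := by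
          have := (mem_openConn_iff' x y ω).1 hh.1
          rw [pendant_reachable_hub_iff hxy.symm (pendant_of_rcWeightW_ne_zero w q hw hω)] at this
          exact this.1
        exact ⟨hP, hh⟩
      · exact fun hh => hh.2
    rw [h1]
    refine pendant_mass_open w hq hxu hxy hyu hw h0y (Exy ∩ Exz) (Kuy ∩ Kuz) (Euy ∩ Euz)
      (insI (insK u y) (insK u z)) (fun ω hω hP => ?_) (fun ω hω => ?_)
    · obtain ⟨e1, e2, -⟩ := asw ω hω hP
      rw [Set.mem_inter_iff, Set.mem_inter_iff, e1, e2]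
    · obtain ⟨e1, e2, -⟩ := asw0 ω hω
      rw [Set.mem_inter_iff, Set.mem_inter_iff, e1, e2]
  have idBxy : Bxy = p * q⁻¹ * Buy := by
    have h1 : Bxy = ∑ ω : BondConfig V, rcWeightW w q ∅ ω * ind ({ω | s(x, u) ∈ ω} ∩ (Exy ∩ Exzᶜ)) ω := by
      refine sum_rcWeightW_ind_congr_ae w q fun ω hω => ?_
      simp only [Set.mem_inter_iff, Set.mem_setOf_eq]
      constructor
      · intro hh
        have hP : s(x, u) ∈ ω := by
          have := (mem_openConn_iff' x y ω).1 hh.1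
          rw [pendant_reachable_hub_iff hxy.symm (pendant_of_rcWeightW_ne_zero w q hw hω)] at this
          exact this.1
        exact ⟨hP, hh⟩
      · exact fun hh => hh.2
    rw [h1]
    refine pendant_mass_open w hq hxu hxy hyu hw h0y (Exy ∩ Exzᶜ) (Kuy ∩ Kuzᶜ) (Euy ∩ Euzᶜ)
      (insI (insK u y) (insC (insK u z))) (fun ω hω hP => ?_) (fun ω hω => ?_)
    · obtain ⟨e1, e2, -⟩ := asw ω hω hP
      rw [Set.mem_inter_iff, Set.mem_inter_iff, Set.mem_compl_iff, Set.mem_compl_iff, e1, e2]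
    · obtain ⟨e1, e2, -⟩ := asw0 ω hω
      rw [Set.mem_inter_iff, Set.mem_inter_iff, Set.mem_compl_iff, Set.mem_compl_iff, e1, e2]
  have idBxz : Bxz = p * q⁻¹ * Buz := by
    have h1 : Bxz = ∑ ω : BondConfig V, rcWeightW w q ∅ ω * ind ({ω | s(x, u) ∈ ω} ∩ (Exyᶜ ∩ Exz)) ω := by
      refine sum_rcWeightW_ind_congr_ae w q fun ω hω => ?_
      simp only [Set.mem_inter_iff, Set.mem_setOf_eq]
      constructor
      · intro hh
        have hP : s(x, u) ∈ ω := by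
          have := (mem_openConn_iff' x z ω).1 hh.2
          rw [pendant_reachable_hub_iff hxz.symm (pendant_of_rcWeightW_ne_zero w q hw hω)] at this
          exact this.1
        exact ⟨hP, hh⟩
      · exact fun hh => hh.2
    rw [h1]
    refine pendant_mass_open w hq hxu hxy hyu hw h0y (Exyᶜ ∩ Exz) (Kuyᶜ ∩ Kuz) (Euyᶜ ∩ Euz)
      (insI (insC (insK u y)) (insK u z)) (fun ω hω hP => ?_) (fun ω hω => ?_)
    · obtain ⟨e1, e2, -⟩ := asw ω hω hP
      rw [Set.mem_inter_iff, Set.mem_inter_iff, Set.mem_compl_iff, Set.mem_compl_iff, e1, e2]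
    · obtain ⟨e1, e2, -⟩ := asw0 ω hω
      rw [Set.mem_inter_iff, Set.mem_inter_iff, Set.mem_compl_iff, Set.mem_compl_iff, e1, e2]
  -- `S°(y ↔ z) = C0 + B0`
  have hSyz : ∑ ω : BondConfig V, rcWeightW w0 q ∅ ω * ind Eyz ω = C0 + B0 := by
    rw [sum_rcWeightW_ind_split w0 q Eyz Euy, hC0, hB0]
    congr 1
    · refine sum_rcWeightW_ind_congr_set w0 q (Set.ext fun ω => ?_)
      simp only [Set.mem_inter_iff]
      constructor
      · rintro ⟨h1, h2⟩; exact ⟨h2, h2.trans h1⟩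
      · rintro ⟨h1, h2⟩; exact ⟨h1.symm.trans h2, h1⟩
    · exact sum_rcWeightW_ind_congr_set w0 q (Set.inter_comm _ _)
  have hZ0sum : Z0 = C0 + Buy + Buz + B0 + A0 := partition_eq_pattern_masses w0 q u y z
  have idByz : Byz = p * q⁻¹ * B0 + (1 - p) * (C0 + B0) := by
    rw [hByz, sum_rcWeightW_ind_split w q (Exyᶜ ∩ Eyz) {ω | s(x, u) ∈ ω}]
    have hop : ∑ ω : BondConfig V, rcWeightW w q ∅ ω * ind (Exyᶜ ∩ Eyz ∩ {ω | s(x, u) ∈ ω}) ω = p * q⁻¹ * B0 := by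
      rw [show Exyᶜ ∩ Eyz ∩ {ω | s(x, u) ∈ ω} = {ω | s(x, u) ∈ ω} ∩ (Exyᶜ ∩ Eyz) from Set.inter_comm _ _]
      refine pendant_mass_open w hq hxu hxy hyu hw h0y (Exyᶜ ∩ Eyz) (Kuyᶜ ∩ Kyz) (Euyᶜ ∩ Eyz)
        (insI (insC (insK u y)) (insK y z)) (fun ω hω hP => ?_) (fun ω hω => ?_)
      · obtain ⟨e1, -, e3⟩ := asw ω hω hP
        rw [Set.mem_inter_iff, Set.mem_inter_iff, Set.mem_compl_iff, Set.mem_compl_iff, e1, e3]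
      · obtain ⟨e1, -, e3, -⟩ := asw0 ω hω
        rw [Set.mem_inter_iff, Set.mem_inter_iff, Set.mem_compl_iff, Set.mem_compl_iff, e1, e3]
    have hcl : ∑ ω : BondConfig V, rcWeightW w q ∅ ω * ind (Exyᶜ ∩ Eyz ∩ {ω | s(x, u) ∈ ω}ᶜ) ω = (1 - p) * (C0 + B0) := by
      rw [show Exyᶜ ∩ Eyz ∩ {ω | s(x, u) ∈ ω}ᶜ = {ω | s(x, u) ∈ ω}ᶜ ∩ (Exyᶜ ∩ Eyz) from Set.inter_comm _ _,
        sum_rcWeightW_ind_compl_openPair_inter w q s(x, u) (Exyᶜ ∩ Eyz), ← hw0, ← hSyz]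
      congr 1
      refine sum_rcWeightW_ind_congr_ae w0 q fun ω hω => ?_
      obtain ⟨-, -, -, e4, -⟩ := asw0 ω hω
      exact ⟨fun hh => hh.2, fun hh => ⟨e4, hh⟩⟩
    rw [hop, hcl]
  have idA : A = p * q⁻¹ * A0 + (1 - p) * (A0 + Buy + Buz) := by
    rw [hA, sum_rcWeightW_ind_split w q (Exyᶜ ∩ Exzᶜ ∩ Eyzᶜ) {ω | s(x, u) ∈ ω}]
    have hop : ∑ ω : BondConfig V, rcWeightW w q ∅ ω * ind (Exyᶜ ∩ Exzᶜ ∩ Eyzᶜ ∩ {ω | s(x, u) ∈ ω}) ω = p * q⁻¹ * A0 := by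
      rw [show Exyᶜ ∩ Exzᶜ ∩ Eyzᶜ ∩ {ω | s(x, u) ∈ ω} = {ω | s(x, u) ∈ ω} ∩ (Exyᶜ ∩ Exzᶜ ∩ Eyzᶜ) from Set.inter_comm _ _]
      refine pendant_mass_open w hq hxu hxy hyu hw h0y (Exyᶜ ∩ Exzᶜ ∩ Eyzᶜ) (Kuyᶜ ∩ Kuzᶜ ∩ Kyzᶜ) (Euyᶜ ∩ Euzᶜ ∩ Eyzᶜ)
        (insI (insI (insC (insK u y)) (insC (insK u z))) (insC (insK y z))) (fun ω hω hP => ?_) (fun ω hω => ?_)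
      · obtain ⟨e1, e2, e3⟩ := asw ω hω hP
        simp only [Set.mem_inter_iff, Set.mem_compl_iff, e1, e2, e3]
      · obtain ⟨e1, e2, e3, -⟩ := asw0 ω hω
        simp only [Set.mem_inter_iff, Set.mem_compl_iff, e1, e2, e3]
    have hcl : ∑ ω : BondConfig V, rcWeightW w q ∅ ω * ind (Exyᶜ ∩ Exzᶜ ∩ Eyzᶜ ∩ {ω | s(x, u) ∈ ω}ᶜ) ω =
        (1 - p) * (A0 + Buy + Buz) := by
      rw [show Exyᶜ ∩ Exzᶜ ∩ Eyzᶜ ∩ {ω | s(x, u) ∈ ω}ᶜ = {ω | s(x, u) ∈ ω}ᶜ ∩ (Exyᶜ ∩ Exzᶜ ∩ Eyzᶜ) from Set.inter_comm _ _,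
        sum_rcWeightW_ind_compl_openPair_inter w q s(x, u) (Exyᶜ ∩ Exzᶜ ∩ Eyzᶜ), ← hw0]
      have hEyzc : ∑ ω : BondConfig V, rcWeightW w0 q ∅ ω * ind (Exyᶜ ∩ Exzᶜ ∩ Eyzᶜ) ω =
          ∑ ω : BondConfig V, rcWeightW w0 q ∅ ω * ind Eyzᶜ ω := by
        refine sum_rcWeightW_ind_congr_ae w0 q fun ω hω => ?_
        obtain ⟨-, -, -, e4, e5⟩ := asw0 ω hω
        simp only [Set.mem_inter_iff, Set.mem_compl_iff, e4, e5, not_false_eq_true, true_and]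
      rw [hEyzc, sum_rcWeightW_ind_compl w0 q Eyz, hSyz, ← hZ0, hZ0sum]
      ring
    rw [hop, hcl]
  have idZ : Z = (1 - p) * Z0 + p * q⁻¹ * Z0 := by
    have hw' : ∀ e : Sym2 V, x ∈ e → ((w e : unitInterval) : ℝ) ≠ 0 → y ∈ e ∨ u ∈ e :=
      fun e hxe hne => Or.inr ((hw e hxe hne).symm ▸ Sym2.mem_mk_right x u)
    have ha : ((w s(y, x) : unitInterval) : ℝ) = 0 := by rw [Sym2.eq_swap]; exact h0y
    have h1 := sum_pendant_update_one w hq hxy hxu hyu hw' ha Set.univ (fun ω => by simp)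
    rw [sum_rcWeightW_ind_univ, sum_rcWeightW_ind_univ, ← hw0, ← hZ0] at h1
    rw [hZ, rcPartitionFunctionW_affine w q s(x, u), h1, ← hw0, ← hZ0]
    ring
  -- nonnegativity of the masses
  have hp0 : 0 ≤ p := (w _).2.1
  have hp1 : p ≤ 1 := (w _).2.2
  have hB0 : 0 ≤ B0 := Finset.sum_nonneg fun ω _ => mul_nonneg (rcWeightW_nonneg _ hq0.le ∅ ω) (ind_nonneg _ ω)
  have hC0' : 0 ≤ C0 := Finset.sum_nonneg fun ω _ => mul_nonneg (rcWeightW_nonneg _ hq0.le ∅ ω) (ind_nonneg _ ω)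
  have hZ0' : 0 ≤ Z0 := (rcPartitionFunctionW_pos w0 hq0 ∅).le
  -- the exact decomposition
  have key : Byz * (Z - (1 - q) * C) - (1 - q) * (A * C - Bxy * Bxz) =
      (1 - p) ^ 2 * ((B0 + C0) * Z0) + (1 - p) * (p * q⁻¹) * (Z0 * (2 * B0 + q * C0)) +
        (p * q⁻¹) ^ 2 * (B0 * (Z0 - (1 - q) * C0) - (1 - q) * (A0 * C0 - Buy * Buz)) := by
    rw [idC, idBxy, idBxz, idByz, idA, idZ, hZ0sum]
    field_simp
    ring
  have t1 : 0 ≤ (1 - p) ^ 2 * ((B0 + C0) * Z0) := mul_nonneg (sq_nonneg _) (mul_nonneg (add_nonneg hB0 hC0') hZ0')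
  have t2 : 0 ≤ (1 - p) * (p * q⁻¹) * (Z0 * (2 * B0 + q * C0)) :=
    mul_nonneg (mul_nonneg (sub_nonneg.2 hp1) (mul_nonneg hp0 (inv_nonneg.2 hq0.le)))
      (mul_nonneg hZ0' (add_nonneg (mul_nonneg zero_le_two hB0) (mul_nonneg hq0.le hC0')))
  have t3 : 0 ≤ (p * q⁻¹) ^ 2 * (B0 * (Z0 - (1 - q) * C0) - (1 - q) * (A0 * C0 - Buy * Buz)) :=
    mul_nonneg (sq_nonneg _) h
  rw [key]
  exact add_nonneg (add_nonneg t1 t2) t3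

/-- **Negative correlation of `xy, xz` at a vertex of degree three** (`0 < q ≤ 1`): if the only live pairs at `x` are `xy`, `xz`,
`xu` (`x, y, z, u` distinct) and the hub covariance bound holds for `φ_{w[xy ↦ 0][xz ↦ 0][xu ↦ 0]}` at the hub `u` and the pair
`y, z` — e.g. because that pinned support is `K₄`-minor-free or lives on `≤ 4` vertices — then `φ_w(J_xy ∩ J_xz) ≤ φ_w(J_xy)φ_w(J_xz)`.
("`Y`-to-`u` reduction": `NC(xy, xz)` in `G` follows from `NC(uy, uz)` in `(G − x) + uy + uz`.) [cite: Grimmett2006, §3.9 eq. (3.94) (p. 63)]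
[cite: Wagner2006, Conj. 5.3 (p. 13)] -/
theorem negCorr_adj_of_degree_three {q : ℝ} (hq0 : 0 < q) (hq1 : q ≤ 1) (w : Sym2 V → unitInterval) {x u y z : V} (hxu : x ≠ u)
    (hxy : x ≠ y) (hxz : x ≠ z) (hyu : y ≠ u) (hzu : z ≠ u) (hyz : y ≠ z)
    (hw : ∀ e : Sym2 V, x ∈ e → ((w e : unitInterval) : ℝ) ≠ 0 → e = s(x, y) ∨ e = s(x, z) ∨ e = s(x, u))
    (h : HubCovBoundUnder
      (rcMeasureW (Function.update (Function.update (Function.update w s(x, y) 0) s(x, z) 0) s(x, u) 0) q ∅) q u y z) :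
    (rcMeasureW w q ∅).real ({ω | s(x, y) ∈ ω} ∩ {ω | s(x, z) ∈ ω}) ≤
      (rcMeasureW w q ∅).real {ω | s(x, y) ∈ ω} * (rcMeasureW w q ∅).real {ω | s(x, z) ∈ ω} := by
  set U : Sym2 V → unitInterval := Function.update (Function.update w s(x, y) 0) s(x, z) 0 with hU
  have hwU : ∀ e : Sym2 V, x ∈ e → ((U e : unitInterval) : ℝ) ≠ 0 → e = s(x, u) := by
    intro e hxe hne
    by_cases h1 : e = s(x, z)
    · subst h1; simp [hU] at hne
    by_cases h2 : e = s(x, y)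
    · subst h2; simp [hU, Function.update_of_ne h1] at hne
    rw [hU, Function.update_of_ne h1, Function.update_of_ne h2] at hne
    rcases hw e hxe hne with h | h | h
    · exact absurd h h2
    · exact absurd h h1
    · exact h
  have hTP := hubCovBoundUnder_of_pendant hq0 U hxu hxy hxz hyu hzu hwU h
  rw [hubCovBoundUnder_iff_threePoint hq0] at hTP
  exact negCorr_adj_of_threePoint hq0 hq1 w x y z hyz (by linarith)

end FK

end Summit.CriticalPhenomena.PercolationContinuityZ3.Theorems

end
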